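import Literature.NumberTheory.LFunctions.Zhang2022.RepairRplusPlus6
import Literature.NumberTheory.LFunctions.Zhang2022.RepairDetShiftUnconditional
import Literature.NumberTheory.LFunctions.Zhang2022.RepairDetGluedUnconditional
import Literature.NumberTheory.LFunctions.Zhang2022.RepairDetEntangledUnconditional
import Literature.NumberTheory.LFunctions.Zhang2022.RepairDetDiscrete
import Literature.NumberTheory.LFunctions.Zhang2022.Section4Prop22Eventually

/-!
# Zhang (2022) §18-margin repair rung — THE RUNNING ASSEMBLY `R⁺⁺`, continuation file (versions 17, …)

Trunk T-ANT (NumberTheory/LFunctions). Y. Zhang, *Discrete mean estimates and the Landau–Siegel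
zero*, arXiv:2211.02515v1 (2022) [Zhang2022LandauSiegel] — **an unrefereed manuscript under
adjudication. WHAT THIS IS NOT: nothing here asserts or denies its Theorems 1–2 or any analytic lemma;
no claim about Landau–Siegel zeros, about Parity, or about a repaired `Margin232` is made. Every
statement is about the manuscript's METHOD AS ARCHITECTED — classes of designs fed to the SAME main-term
calculus (or to a displayed MODEL main term) — not about zeros of `L`-functions. The programme SEARCHES and
TYPES; no claim about Landau–Siegel zeros, Theorems 1–2 of arXiv:2211.02515 or a repaired Margin232 until a
kernel theorem says so.** Cell `landau-siegel` (rung F-S3), sub-cell E; stub S-E-p1-1 «running assembly» of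
barrier/ASSIGNMENTS.md (ls-barrier-p1 g3's CHECKED TEMPLATE `RepairRplusPlus7.v17-template.lean` 420ed1619f65f2f6, 03:52:36Z:
«for whoever files v17 at S-E-p6-6 ACCEPT»; filed by ls-barrier-p6 g3, the S-E-p6-6 / S-E-p6-3 pen).

Continuation of `RepairRplusPlus` (0–3), `RepairRplusPlus2` (4–6), `RepairRplusPlus3` (7–8), `RepairRplusPlus4` (9–11),
`RepairRplusPlus5` (12–13) and `RepairRplusPlus6` (14–16; class of record before this file = `Repair.Rplusplus16`, p482146,
54 families, with `rplusplus16_words_sub` = the B-multi v6 / B-len v4 / B-det v2 / B-ell intake lists as sub-lists); those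
files reached their line budget. Same protocol (`Repair.DesignFamily`, `ClassDecided`, append-only versions `Rplusplus<k>`,
class OF RECORD = the last version, named in barrier/BARRIER-STATE.md; per version: `Rplusplus<k>`, `rplusplus<k>_decided` by
`classDecided_append` — nothing re-proved —, `mem_rplusplus<k>_iff`, prefix lemma, sub-list recoveries, the intake lists of
record as sub-lists, the verdicts, table rows in a `/-! ### Version k -/` section).

## Class table — version 17 (rows 55–57: the shift-detector rows READ UNCONDITIONALLY — E-010 and the two-sided slots
## discharged class-wide by the DOUBLING / CIRCLE chains)

| # | family (decl) | designs, K in words | V (currency) | displayed inputs (kind) | p-id (file) | flag |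
|---|---|---|---|---|---|---|
| 55 «det shift, unconditional» | `familyDetShiftUncond` | `DetShiftDesign (b; u,u′; f,f′)` with `Det.SignAdmissible b ∧ Det.InShiftBox b` ∧ one-sided kinked legs, `u(1) = f(1) = 0` — row 17's class EXACTLY (`familyDetShiftUncond_sameClass`; `rplusplus17_row55_sameClass_row17`) | FormDet currency, SLOT-FREE: `¬ (𝔅_b(u)·𝔅_b(f) < ‖P_b(u,f)‖²)` — the conclusion of row 17 itself (`Repair.detShift_not_closing`) | none: row 17's slot `Det.FormDetPSD (shiftRecipe b)` (E-010) is a THEOREM for every sign-admissible `b` (`Det.formDetPSD_shiftRecipe_of_signAdmissible`, K6 Part 3, p490608) | p494868 (`RepairDetShiftUnconditional`, ls-barrier-p6 g3, S-E-p6-6) ← p490608 (K6 Part 3, ls-Bdet-typer-2 g2; chain K1 p485967 ls-barrier-p2 · K2 p488794 ls-barrier-p5 · K3 p487045 ls-Bmulti-typer-2 · K4/K5) ← p460173 (row 17) | **UNCONDITIONAL** — the slot-free ROW OF RECORD for row 17 («det shift, E-010 discharged class-wide», ls-barrier-plan g1 02:54:15Z (1) / 03:00:04Z (b); REF-E E-9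 PASS 04:08Z «row 17 UNIFORM»); **coverage counted ONCE** (rows 17 and 55 have the same class) |
| 56 «det glued (two-sided legs, any overlap), unconditional» | `familyDetGluedUncond` | `DetShiftDesign (b; G,G′; f,f′)` with `Det.SignAdmissible b ∧ Det.InShiftBox b` ∧ `H¹` legs `G`, `f` on `[0,1]` — NO apex condition: glued two-sided `H`-profiles `g₁ + R̃g₂` with ANY overlap, one-sided profiles, tents crossing the reflected side; = the class of the slot-displayed twin `familyDetGlued` EXACTLY (`familyDetGluedUncond_sameClass`); the B-det intake's item (u3) «two-sided / glued legs at general b» | DictShift currency (the cell's windowed glued main-term form `Det.DictShift b`, = (4.1)/`C₂₃₂S` at `(1,2,3)` window included, = `Det.FormDetGlued` on no-overlap sides, = formula I on one-sided legs), SLOT-FREE: `¬ (DictShift_b(G)·DictShift_b(f) < ‖P^dict_b(G,f)‖²)` (`Repair.detGlued_not_closing`); at `(1,2,3)` on `(𝔤_θ, f_θ)` = row 1's `¬ (C₂₃₂S·C₂₃₃T < |𝔡+𝔡′|²)` (`detGlued_std_gluedLeg_verdict_iff`) | none: the slot `Det.DictShiftPSD b` (dictionary PSD on ALL `H¹` profiles)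 is a THEOREM for every sign-admissible `b` (`Det.dictShiftPSD_of_signAdmissible`, K7 Part 4, p495442; sharp: ⟸⟹ `SignAdmissible`, ls-barrier-num 04:06:43Z, paper) | p495442 (`DetectorDictShiftDischarge`, ls-barrier-p6 g3) ← p494536 (K7 Part 3 `H¹` lift) ← p493749 (K7 Parts 1–2 K1‴ + circle; twin p493897 `DetectorDictCircle`, ls-barrier-num g3) ← p492723 (K2″ `DetectorTwoPointIdentity`, ls-barrier-num g3) ← p488397 (K3′) ← p492465 (`RepairDetGlued`, the twin row `familyDetGlued`, S-E-p6-3) ← p491931 (`DetectorDictFormCS`) | **UNCONDITIONAL** — COVERAGE row (ls-barrier-plan g1 03:23:31Z (1): «THRESHOLD/intake-members row until [the slot is a theorem ∀ SignAdmissible b], a COVERAGE row (p1 new file) after»); identities Id-5/Id-7 of record ls-num-2 g4 (two lineages exact), ls-theory PASS 02:50:28Z / 03:22:06Z |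
| 57 «det glued, no-overlap split, unconditional» | `familyDetGluedSepUncond` | `DetGluedSepDesign (b; t₁,t₂; g₁,g₂; f₁,f₂)`: `Det.SignAdmissible b ∧ Det.InShiftBox b`, a no-overlap split `0 ≤ t₁, t₂`, `t₁ + t₂ ≤ 1`, `H`-sides and probe sides kinked on that split (`Det.SidesAt`) — Family B's class EXACTLY (`familyDetGluedSepUncond_sameClass`; `rplusplus17_row57_sameClass_sep`) | FormDetGlued currency, SLOT-FREE: `¬ (FormDetGlued_b(g₁,g₂)·FormDetGlued_b(f₁,f₂) < ‖P^dict_b(g₁+R̃g₂, f₁+R̃f₂)‖²)` (`Repair.detGluedSep_not_closing`) | none: Family B's slot `Det.GluedFormPSD b` is a THEOREM for every sign-admissible `b` (`Det.gluedFormPSD_of_signAdmissible`, ls-barrier-p5 g4 `DetectorTwoSidedGlued` p495072; also from `dictShiftPSD_of_signAdmissible` by `DictShiftPSD.gluedFormPSD`) | p495794 (`RepairDetGluedUnconditional`, ls-barrier-p5 g4) ← p495072 (K1″+K6″, S-E-p5-13) ← p492723 (K2″) ← p488397 (K3′) ← p492465 (`RepairDetGlued`, the slot-displayed twin `familyDetGluedSep`,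 ls-barrier-p6 g3, S-E-p6-3 Family B) | **UNCONDITIONAL** — COVERAGE row, the no-overlap sub-class of row 56 in the pair currency (REF-E E-41 PASS 04:17Z «Family B UNCONDITIONAL on its whole class»; N1 resolved without a node set) |

**E-102 IN FULL is a kernel theorem as of this version** (`Det.edetPremise_unit : EdetPremise (Ioo 0 1) (Ioo 0 5)`,
`DetectorEntangledConePSD`, ls-barrier-p2 g4 p496401, with head 2 `Det.monomialConePSD_unit` p490608 and head 1
`Det.edetCone_unit`): row 40 `familyDetEntangled` and the intake list `bdetWord2` read OUTRIGHT by
`Repair.bdet2_verdicts_of_edetPremise Det.edetPremise_unit`; the slot-free row object (row-55 pattern,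
`Repair.familyDetEntangledUncond`, `Repair.bdet2_verdicts`) is ls-Bdet-typer-2 g3's CLAIMED leaf
`RepairDetEntangledUnconditional` (04:20Z) and enters as a row in version 18 — not typed here to avoid a duplicate. The slot-displayed twins `Repair.familyDetGlued` / `Repair.familyDetGluedSep` (p492465;
verdicts `DictShiftPSD b → …` / `GluedFormPSD b → …`) are NOT entered as separate rows (same classes as rows 56 / 57, verdicts
implied: `familyDetGlued_verdict_and_slot`, `familyDetGluedSep_verdict_and_slot`), unlike rows 17/55 where row 17 was already
in the class.

## Errata carried by this version (docstring only; no row added or dropped for them)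

1. **Rows 41–44 (version 13) — flag re-worded** (ls-barrier-plan g1 01:54:33Z; REF-E E-29 ERRATUM v2; ls-barrier-p2 g3 withdrew
   the desk note 01:21:48Z, BANDMV-MODEL.md a6f01211308c78ad): the version-15 words «premise model-false / NOT probative» on rows
   41–44 are WITHDRAWN. Rows 41–44 = true implications under the logically stronger all-coefficients premise E-004′
   (`BandMeanValue`, also expected true — no flag); superseded AS ROWS OF RECORD by rows 50–53 (E-004″ `BandMeanValueLip`, room
   𝓛⁶ sharp for the method, p481421 / p482920); coverage counted once; registry E-108 USE-GUARD / E-109 slot of record.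
2. **Row 17 (version 4) — flag history**: E-010 discharged on SEVEN triples {(1,2,3), b⋆, b⋆⋆, b⋆₃, b⋆₄, b⋆₅, b♯₄}
   (`Det.formDetPSD_shiftRecipe_discharged7`, `Repair.detShift_unconditional_of_discharged7`, p488492, REF-E g3 02:27Z «off the
   seven»); CLASS-WIDE by row 55 of this version (p490608 + p494868); REF-E E-9 PASS 04:08Z: row 17's flag of record is
   «UNCONDITIONAL on the sign-admissible box».
3. **Row 40 (version 12) and `bdetWord2` — flag «GIVEN E-102» DISCHARGED** by `Det.edetPremise_unit` (p496401): both conditional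
   rows of the B-det intake read outright (`Repair.bdet2_verdicts_of_edetPremise Det.edetPremise_unit`); row object in version 18.

## References

* Y. Zhang, arXiv:2211.02515v1 (2022), §2 Lemma 2.3, (2.10), (2.13), (2.15)–(2.20), (2.23)–(2.25), (2.27), (2.30)–(2.33)
  [p. 4–11], §4 (4.1), §7 Prop. 7.1, (7.2) [p. 44], §8 Lemma 8.1, (8.2), (8.23), §12 (12.6)–(12.8), Prop. 14.1, Lemma 15.1,
  §18 (18.1). [cite: Zhang2022LandauSiegel, §§2, 4, 7, 8, 12, 14, 15, 18]
-/

noncomputable section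

open scoped ComplexOrder NNReal

namespace Literature.NumberTheory.LFunctions.Zhang2022

namespace Repair

/-! ### Version 17 (2026-08-27): the unconditional shift-detector rows 55–57 (E-010 and the two-sided slots discharged) -/

/-- **`R⁺⁺`, version 17**: version 16 (`RepairRplusPlus6.Rplusplus16`, 54 families) followed by the slot-free one-sided
shift-detector family (`familyDetShiftUncond`, row 55 — the row of record for row 17; coverage counted once), the slot-free
GLUED shift-detector family (`familyDetGluedUncond`, row 56 — two-sided legs with any overlap) and the slot-free no-overlap
split family (`familyDetGluedSepUncond`, row 57). [cite: Zhang2022LandauSiegel, §2 (2.13), (2.18), (2.27), (2.32)–(2.33); §7 (7.2); §12 (12.6)–(12.8)] -/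
def Rplusplus17 : List DesignFamily := Rplusplus16 ++ [familyDetShiftUncond, familyDetGluedUncond, familyDetGluedSepUncond]

/-- **Version 17 is decided**: `rplusplus16_decided` for rows 1–54 and `familyDetShiftUncond_decided` (p494868),
`familyDetGluedUncond_decided` (p495442), `familyDetGluedSepUncond_decided` (p495794) for rows 55–57; nothing re-proved.
[cite: Zhang2022LandauSiegel, §2 Props. 2.4–2.6, (2.32)–(2.33)] -/
theorem rplusplus17_decided : ClassDecided Rplusplus17 :=
  classDecided_append.2 ⟨rplusplus16_decided, classDecided_cons familyDetShiftUncond_decided <|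
    classDecided_cons familyDetGluedUncond_decided <| classDecided_cons familyDetGluedSepUncond_decided classDecided_nil⟩

/-- The families of version 17, by name (the class is EXACTLY these fifty-seven).
[cite: Zhang2022LandauSiegel, §2 (2.32)–(2.33)] -/
theorem mem_rplusplus17_iff (F : DesignFamily) :
    F ∈ Rplusplus17 ↔ F = familyR ∨ F = familyH1 ∨ F = familyTwoPiece ∨ F = familyFarPiece ∨
      F = familyRWide ∨ F = familyRCalc ∨ F = KnifeEdge.familyRoughTwoPiece ∨ F = familyRLengths ∨
      F = familySmoothLengths ∨ F = familySmoothTop ∨ F = familyTwoPieceJoint ∨ F = familyWallZero ∨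
      F = familyWallZeroTop ∨ F = familyInPrintLen ∨ F = KnifeEdge.familyWallBand ∨ F = familyJumpBlockAll ∨
      F = familyDetShift ∨ F = KnifeEdge.familyRoughThreePiece ∨ F = KnifeEdge.familyRoughTwoPieceJoint ∨
      F = familyFarBV ∨ F = familyLambdaBlockAll ∨ F = familyWallZeroMain ∨ F = familyWallZeroTopMain ∨
      F = KnifeEdge.familyGramBlockAll ∨ F = familyLambdaOverhangAll ∨ F = familyLambdaGradedAll ∨
      F = KnifeEdge.familyGramBlockDict ∨ F = KnifeEdge.familyGramBordered ∨ F = familyMuPsiOverhangAll ∨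
      F = familyNuOverhangAll ∨ F = familyBandEdge ∨ F = familySmoothBandEdge ∨ F = familySmoothTopBandEdge ∨
      F = familyNuLipOverhangAll ∨ F = familyWallZeroTrueBand ∨ F = familyWallZeroTopTrueBand ∨
      F = familySmoothWallZeroTrueBand ∨ F = familySmoothTopWallZeroTrueBand ∨ F = familyLambdaWholeAll ∨
      F = familyDetEntangled ∨ F = familyWallZeroBandMV ∨ F = familyWallZeroTopBandMV ∨
      F = familySmoothWallZeroBandMV ∨ F = familySmoothTopWallZeroBandMV ∨ F = familyBellOnePiece ∨
      F = familyBellK0Plane ∨ F = familyBellFirstOrder ∨ F = familyBellCSEdge ∨ F = familyBellSubcritical ∨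
      F = familyWallZeroBandMVLip ∨ F = familyWallZeroTopBandMVLip ∨ F = familySmoothWallZeroBandMVLip ∨
      F = familySmoothTopWallZeroBandMVLip ∨ F = familyInPrintCeiling ∨ F = familyDetShiftUncond ∨
      F = familyDetGluedUncond ∨ F = familyDetGluedSepUncond := by
  simp only [Rplusplus17, Rplusplus16, Rplusplus15, Rplusplus14, Rplusplus13, Rplusplus12, Rplusplus11, Rplusplus10,
    Rplusplus9, Rplusplus8, Rplusplus7, Rplusplus6, Rplusplus5, Rplusplus4, Rplusplus3, Rplusplus2, Rplusplus1, Rplus,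
    List.cons_append, List.nil_append, List.mem_cons, List.not_mem_nil, or_false]

/-- **Version 16 ⊆ version 17** (list prefix: no family dropped). [cite: Zhang2022LandauSiegel, §2 (2.32)–(2.33)] -/
theorem rplusplus16_sub_rplusplus17 : ∀ F ∈ Rplusplus16, F ∈ Rplusplus17 :=
  fun _ hF => List.mem_append.2 (Or.inl hF)

/-- `R⁺ ⊆` version 17. [cite: Zhang2022LandauSiegel, §2 (2.32)–(2.33)] -/
theorem rplus_sub_rplusplus17 : ∀ F ∈ Rplus, F ∈ Rplusplus17 :=
  fun F hF => rplusplus16_sub_rplusplus17 F (rplus_sub_rplusplus16 F hF)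

/-- Version 17 restricted to version 16, and the three new families' own `R⁺`-extensions as sub-lists.
[cite: Zhang2022LandauSiegel, §2 (2.32)–(2.33)] -/
theorem rplusplus17_decided_sublists :
    ClassDecided Rplusplus16 ∧ ClassDecided (Rplus ++ [familyDetShiftUncond]) ∧
      ClassDecided (Rplus ++ [familyDetGluedUncond]) ∧ ClassDecided (Rplus ++ [familyDetGluedSepUncond]) :=
  ⟨rplusplus17_decided.mono rplusplus16_sub_rplusplus17, rplus_detShiftUncond_decided, rplus_detGluedUncond_decided,
    rplus_detGluedSepUncond_decided⟩

/-- **The four design-class words' current intake lists are inside version 17** (inherited from `rplusplus16_words_sub`).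
[cite: Zhang2022LandauSiegel, §2 (2.32)–(2.33)] -/
theorem rplusplus17_words_sub :
    (∀ F ∈ bmultiWord6, F ∈ Rplusplus17) ∧ (∀ F ∈ blenWord4, F ∈ Rplusplus17) ∧ (∀ F ∈ bdetWord2, F ∈ Rplusplus17) ∧
      (∀ F ∈ bellWord, F ∈ Rplusplus17) :=
  ⟨fun F hF => rplusplus16_sub_rplusplus17 F (rplusplus16_words_sub.1 F hF),
    fun F hF => rplusplus16_sub_rplusplus17 F (rplusplus16_words_sub.2.1 F hF),
    fun F hF => rplusplus16_sub_rplusplus17 F (rplusplus16_words_sub.2.2.1 F hF),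
    fun F hF => rplusplus16_sub_rplusplus17 F (rplusplus16_words_sub.2.2.2 F hF)⟩

/-- **Rows 17, 55, 56, 57 are all in version 17** (the conditional row 17 is kept; 55 is its row of record).
[cite: Zhang2022LandauSiegel, §2 (2.32)–(2.33)] -/
theorem rplusplus17_detShift_rows :
    familyDetShift ∈ Rplusplus17 ∧ familyDetShiftUncond ∈ Rplusplus17 ∧ familyDetGluedUncond ∈ Rplusplus17 ∧
      familyDetGluedSepUncond ∈ Rplusplus17 :=
  ⟨(mem_rplusplus17_iff _).2 (by simp only [true_or, or_true]), (mem_rplusplus17_iff _).2 (by simp only [true_or, or_true]),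
    (mem_rplusplus17_iff _).2 (by simp only [true_or, or_true]), (mem_rplusplus17_iff _).2 (by simp only [or_true])⟩

/-- **Rows 17 and 55 have the same class** (only the verdict changed: slot removed).
[cite: Zhang2022LandauSiegel, §2 (2.32)–(2.33)] -/
theorem rplusplus17_row55_sameClass_row17 (d : DetShiftDesign) :
    familyDetShiftUncond.InClass d ↔ familyDetShift.InClass d :=
  familyDetShiftUncond_sameClass.2 d

/-- **Row 56 has the class of the slot-displayed twin `familyDetGlued`** (not a row; same designs, verdict implied).
[cite: Zhang2022LandauSiegel, §2 (2.32)–(2.33)] -/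
theorem rplusplus17_row56_sameClass_glued (d : DetShiftDesign) :
    familyDetGluedUncond.InClass d ↔ familyDetGlued.InClass d :=
  familyDetGluedUncond_sameClass.2 d

/-- **Row 57 has the class of the slot-displayed twin `familyDetGluedSep`** (Family B; not a row).
[cite: Zhang2022LandauSiegel, §2 (2.32)–(2.33)] -/
theorem rplusplus17_row57_sameClass_sep (d : DetGluedSepDesign) :
    familyDetGluedSepUncond.InClass d ↔ familyDetGluedSep.InClass d :=
  familyDetGluedSepUncond_sameClass.2 d

/-- **Row 17's members are row 56 members** (one-sided kinked legs are `H¹` legs): the glued row extends row 17's designs.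
[cite: Zhang2022LandauSiegel, §7 (7.2) p.44; §2 (2.32)–(2.33)] -/
theorem rplusplus17_row17_sub_row56 (d : DetShiftDesign) (h : familyDetShift.InClass d) : familyDetGluedUncond.InClass d :=
  inClassGlued_of_inClass d h

/-- **The verdicts of rows 55–57 on every member, by name** (all UNCONDITIONAL).
[cite: Zhang2022LandauSiegel, §2 Props. 2.4–2.6, (2.32)–(2.33)] -/
theorem rplusplus17_verdicts :
    (∀ d : DetShiftDesign, d.InClass →
      ¬ (Det.FormDet (Det.shiftRecipe d.b) d.u d.u' * Det.FormDet (Det.shiftRecipe d.b) d.f d.f'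
          < ‖Det.FormDetPolar (Det.shiftRecipe d.b) d.u d.u' d.f d.f'‖ ^ 2)) ∧
    (∀ d : DetShiftDesign, d.InClassGlued →
      ¬ (Det.DictShift d.b d.u d.u' * Det.DictShift d.b d.f d.f' < ‖Det.DictShiftPolar d.b d.u d.u' d.f d.f'‖ ^ 2)) ∧
    (∀ d : DetGluedSepDesign, d.InClass →
      ¬ (Det.FormDetGlued d.b d.g₁ d.g₁' d.g₂ d.g₂' * Det.FormDetGlued d.b d.f₁ d.f₁' d.f₂ d.f₂' <
          ‖Det.DictShiftPolar d.b (Det.gluedProfile d.g₁ d.g₂) (Det.gluedDeriv d.g₁' d.g₂')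
              (Det.gluedProfile d.f₁ d.f₂) (Det.gluedDeriv d.f₁' d.f₂')‖ ^ 2)) :=
  ⟨detShift_not_closing, detGlued_not_closing, detGluedSep_not_closing⟩

/-- **At the printed triple the glued row 56 re-derives row 1** (`familyR` / `familyRCalc`): for every calculus-class `θ`,
`¬ (C₂₃₂S θ·C₂₃₃T θ < ‖dSumS θ‖²)` through `familyDetGluedUncond` on the manuscript's own glued legs `(𝔤_θ, f_θ)`.
[cite: Zhang2022LandauSiegel, §2 (2.32)–(2.33); §10 (10.1)] -/
theorem rplusplus17_row56_std_is_row1 {θ : Theta} (hθ : AdmissibleThetaCalc θ) :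
    ¬ (C232S θ * C233T θ < ‖dSumS θ‖ ^ 2) :=
  detGlued_std_gluedLeg_verdict hθ

/-! ### Version 18 (2026-08-27): row 58 — the ENTANGLED `K`-block detector family read OUTRIGHT (E-102 head 1 discharged) -/

/-- **`R⁺⁺`, version 18**: version 17 followed by the slot-free ENTANGLED detector family `familyDetEntangledUncond`
(`RepairDetEntangledUnconditional`, ls-Bdet-typer-2 g3 p496742) — row 58, the row of record for row 40 `familyDetEntangled`
(same designs `DetEntangledDesign (K, a, b, h, h′)`, same class — `familyDetEntangledUncond_sameClass`; verdict = the bare block-form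
conclusion `¬ (Re m(a;b;h) < 0)`, NO slot: E-102 head 1 `Det.edetCone_unit` p496401 (SOS route, ls-barrier-p2 g4), head 2
`Det.monomialConePSD_unit` p490608; coverage counted once). [cite: Zhang2022LandauSiegel, §2 (2.13), Lemma 2.3, (2.32)–(2.33); §7 Prop 7.1 (7.2)] -/
def Rplusplus18 : List DesignFamily := Rplusplus17 ++ [familyDetEntangledUncond]

/-- **Version 18 is decided**: `rplusplus17_decided` for rows 1–57 and `familyDetEntangledUncond_decided` (p496742) for row 58;
nothing re-proved. [cite: Zhang2022LandauSiegel, §2 Props. 2.4–2.6, (2.32)–(2.33)] -/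
theorem rplusplus18_decided : ClassDecided Rplusplus18 :=
  classDecided_snoc rplusplus17_decided familyDetEntangledUncond_decided

/-- Membership in version 18: a version-17 family or row 58. [cite: Zhang2022LandauSiegel, §2 (2.32)–(2.33)] -/
theorem mem_rplusplus18_iff (F : DesignFamily) : F ∈ Rplusplus18 ↔ F ∈ Rplusplus17 ∨ F = familyDetEntangledUncond := by
  simp only [Rplusplus18, List.mem_append, List.mem_cons, List.not_mem_nil, or_false]

/-- **Version 17 ⊆ version 18** (list prefix: no family dropped). [cite: Zhang2022LandauSiegel, §2 (2.32)–(2.33)] -/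
theorem rplusplus17_sub_rplusplus18 : ∀ F ∈ Rplusplus17, F ∈ Rplusplus18 :=
  fun _ hF => List.mem_append.2 (Or.inl hF)

/-- `R⁺ ⊆` version 18. [cite: Zhang2022LandauSiegel, §2 (2.32)–(2.33)] -/
theorem rplus_sub_rplusplus18 : ∀ F ∈ Rplus, F ∈ Rplusplus18 :=
  fun F hF => rplusplus17_sub_rplusplus18 F (rplus_sub_rplusplus17 F hF)

/-- **The four design-class words' current intake lists are inside version 18** (inherited from `rplusplus17_words_sub`;
`bdetWord2`'s two conditional rows now read OUTRIGHT — `Repair.bdet2_verdicts`, p496742). [cite: Zhang2022LandauSiegel, §2 (2.32)–(2.33)] -/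
theorem rplusplus18_words_sub :
    (∀ F ∈ bmultiWord6, F ∈ Rplusplus18) ∧ (∀ F ∈ blenWord4, F ∈ Rplusplus18) ∧ (∀ F ∈ bdetWord2, F ∈ Rplusplus18) ∧
      (∀ F ∈ bellWord, F ∈ Rplusplus18) :=
  ⟨fun F hF => rplusplus17_sub_rplusplus18 F (rplusplus17_words_sub.1 F hF),
    fun F hF => rplusplus17_sub_rplusplus18 F (rplusplus17_words_sub.2.1 F hF),
    fun F hF => rplusplus17_sub_rplusplus18 F (rplusplus17_words_sub.2.2.1 F hF),
    fun F hF => rplusplus17_sub_rplusplus18 F (rplusplus17_words_sub.2.2.2 F hF)⟩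

/-- **Rows 40 and 58 are both in version 18** (the conditional row 40 is kept; 58 is its row of record).
[cite: Zhang2022LandauSiegel, §2 (2.32)–(2.33)] -/
theorem rplusplus18_detEntangled_rows : familyDetEntangled ∈ Rplusplus18 ∧ familyDetEntangledUncond ∈ Rplusplus18 :=
  ⟨rplusplus17_sub_rplusplus18 _ ((mem_rplusplus17_iff _).2 (by simp only [true_or, or_true])),
    (mem_rplusplus18_iff _).2 (Or.inr rfl)⟩

/-- **Rows 40 and 58 have the same class** (only the verdict changed: slot removed). [cite: Zhang2022LandauSiegel, §2 (2.32)–(2.33)] -/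
theorem rplusplus18_row58_sameClass_row40 (d : DetEntangledDesign) :
    familyDetEntangledUncond.InClass d ↔ familyDetEntangled.InClass d :=
  familyDetEntangledUncond_sameClass.2 d

/-! ### Version 19 (2026-08-27): rows 59–60 — the DISCRETE-LEVEL detector rows (kind THRESHOLD / DISCRETE currency;
### `RepairDetDiscrete`, ls-barrier-p6 g3 p496281; REF-E E-45 PASS 04:57:31Z «bookable as two THRESHOLD-type rows») -/

section Version19

open Det DetTemplate Skeleton

/-- **`R⁺⁺`, version 19**: version 18 followed by the two DISCRETE-currency detector families of `RepairDetDiscrete`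
(ls-barrier-p6 g3, p496281; REF-E E-45): row 59 `familyDetPositive` — EVERY (a)-member of class DET (`Det.DETDesign k`, any
`k`) with ANY configuration-valid endgame `Φ` (`Det.ConfigValid`), the member's positivity `(d.detector c′).Positive`
DISPLAYED per member (kind THRESHOLD: «no configuration-valid endgame closes on the EXACT discrete means of an (a)-member»);
row 60 `familyDetShiftDiscrete` — the sign-admissible shift detectors (`Det.SignAdmissible b ∧ Det.InShiftBox b`, `0 ≤ c′`)
at the discrete level GIVEN `Skeleton.Prop22 c′` ONLY (displayed; a tree theorem for every `c′ ≥ c₀`: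
`rplusplus19_row60_closed`). Currency DISCRETE (the member's exact means at every large `D`); nothing about the evaluated
main terms — rows 17 / 55–58 are untouched; coverage of the B-det intake is unchanged (these are THRESHOLD rows, booked so
that item (u1)/(u4) of `RepairIntakeBdet` has its rows in the class of record; ls-barrier-plan g2 ROW WORD «BOOK» 05:33:11Z).
`c′` ranges over `ℝ≥0` in the Design, so members with `c′ ≥ c₀` exist for every `(b, r, Φ)`: the read-back
`rplusplus19_row60_closed` is not vacuous (`rplusplus19_row60_member`; referee probe BN); members with `c′ < c₀` keep the
displayed `Skeleton.Prop22 c′`. [cite: Zhang2022LandauSiegel, §2 (2.13)–(2.19), Lemma 2.3, (2.32)–(2.34)] -/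
def Rplusplus19 : List DesignFamily := Rplusplus18 ++ [familyDetPositive, familyDetShiftDiscrete]

/-- **Version 19 is decided**: `rplusplus18_decided` for rows 1–58 and `familyDetPositive_decided`,
`familyDetShiftDiscrete_decided` (p496281) for rows 59–60; nothing re-proved. [cite: Zhang2022LandauSiegel, §2 (2.16)–(2.19), (2.32)–(2.33)] -/
theorem rplusplus19_decided : ClassDecided Rplusplus19 :=
  classDecided_append.2 ⟨rplusplus18_decided,
    classDecided_cons familyDetPositive_decided (classDecided_cons familyDetShiftDiscrete_decided classDecided_nil)⟩

/-- Membership in version 19: a version-18 family or one of rows 59, 60. [cite: Zhang2022LandauSiegel, §2 (2.32)–(2.33)] -/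
theorem mem_rplusplus19_iff (F : DesignFamily) :
    F ∈ Rplusplus19 ↔ F ∈ Rplusplus18 ∨ F = familyDetPositive ∨ F = familyDetShiftDiscrete := by
  simp only [Rplusplus19, List.mem_append, List.mem_cons, List.not_mem_nil, or_false]

/-- **Version 18 ⊆ version 19** (list prefix: no family dropped). [cite: Zhang2022LandauSiegel, §2 (2.32)–(2.33)] -/
theorem rplusplus18_sub_rplusplus19 : ∀ F ∈ Rplusplus18, F ∈ Rplusplus19 :=
  fun _ hF => List.mem_append.2 (Or.inl hF)

/-- `R⁺ ⊆` version 19. [cite: Zhang2022LandauSiegel, §2 (2.32)–(2.33)] -/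
theorem rplus_sub_rplusplus19 : ∀ F ∈ Rplus, F ∈ Rplusplus19 :=
  fun F hF => rplusplus18_sub_rplusplus19 F (rplus_sub_rplusplus18 F hF)

/-- **The four design-class words' current intake lists are inside version 19** (inherited from `rplusplus18_words_sub`).
[cite: Zhang2022LandauSiegel, §2 (2.32)–(2.33)] -/
theorem rplusplus19_words_sub :
    (∀ F ∈ bmultiWord6, F ∈ Rplusplus19) ∧ (∀ F ∈ blenWord4, F ∈ Rplusplus19) ∧ (∀ F ∈ bdetWord2, F ∈ Rplusplus19) ∧
      (∀ F ∈ bellWord, F ∈ Rplusplus19) :=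
  ⟨fun F hF => rplusplus18_sub_rplusplus19 F (rplusplus18_words_sub.1 F hF),
    fun F hF => rplusplus18_sub_rplusplus19 F (rplusplus18_words_sub.2.1 F hF),
    fun F hF => rplusplus18_sub_rplusplus19 F (rplusplus18_words_sub.2.2.1 F hF),
    fun F hF => rplusplus18_sub_rplusplus19 F (rplusplus18_words_sub.2.2.2 F hF)⟩

/-- **Rows 59 and 60 are in version 19**, and the two rows alone extend `R⁺` (`rplus_detDiscrete_both_decided`, p496281).
[cite: Zhang2022LandauSiegel, §2 (2.32)–(2.33)] -/
theorem rplusplus19_detDiscrete_rows :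
    (familyDetPositive ∈ Rplusplus19 ∧ familyDetShiftDiscrete ∈ Rplusplus19) ∧
      ClassDecided (Rplus ++ [familyDetPositive, familyDetShiftDiscrete]) :=
  ⟨⟨(mem_rplusplus19_iff _).2 (Or.inr (Or.inl rfl)), (mem_rplusplus19_iff _).2 (Or.inr (Or.inr rfl))⟩,
    rplus_detDiscrete_both_decided⟩

/-- **Row 60's members are row-59 members** (`DetShiftDiscreteDesign.toPositive`: the same detector `Det.shiftDesign ⟨b, (−1,1,−1)⟩`
and the same endgame), and GIVEN Prop. 2.2 the displayed positivity of row 59 is DISCHARGED on them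
(`detShiftDiscrete_toPositive`). [cite: Zhang2022LandauSiegel, §2 Prop. 2.2, Lemma 2.3] -/
theorem rplusplus19_row60_sub_row59 (p : DetShiftDiscreteDesign) (h : familyDetShiftDiscrete.InClass p)
    (hbox : InShiftBox p.b) :
    familyDetPositive.InClass (p.toPositive hbox) ∧
      (Skeleton.Prop22 p.c' → ((p.toPositive hbox).d.detector p.c').Positive) :=
  detShiftDiscrete_toPositive p h hbox

/-- **Read-back at version 19 — ROW 60 IS UNCONDITIONAL FOR `c′ ≥ c₀`**: the only displayed input of row 60, `Skeleton.Prop22 c′`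
(the manuscript's Prop. 2.2 (i)–(iii)), is a TREE THEOREM for every `c′ ≥ c₀` (`Skeleton.prop22_eventually`, no hypothesis);
hence there is ONE `c₀ ≥ 0` such that every row-60 member with `c′ ≥ c₀` satisfies the row's conclusion OUTRIGHT: for all large
`D`, every real primitive `χ`, every test families, `¬ (Φ (gram) < 0)`. (The referee's closed twin `refE_rowS_closed` of REF-E
E-45, typed; row 59's per-member positivity stays displayed.) [cite: Zhang2022LandauSiegel, §2 Prop. 2.2, Lemma 2.3, (2.16)–(2.19), (2.34)] -/
theorem rplusplus19_row60_closed :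
    ∃ c₀ : ℝ, 0 ≤ c₀ ∧ ∀ p : DetShiftDiscreteDesign, p.InClass → c₀ ≤ p.c' → ∀ hbox : InShiftBox p.b,
      ForAllLarge fun D _ χ => ∀ u : Fin p.r → (_ : Chr D) × ℂ → ℂ,
        ¬ (p.Φ (((shiftDesign ⟨p.b, ![-1, 1, -1]⟩ hbox).detector p.c').gram χ u) < 0) := by
  obtain ⟨c₀, hc₀, h22⟩ := prop22_eventually
  exact ⟨c₀, hc₀, fun p hp hc hbox => not_repairable_detShiftDiscrete p hp hbox (h22 _ hc)⟩

/-- **The read-back is not vacuous**: for every threshold `c₀` and every class data `(b, r, Φ)` (`b` sign-admissible in the box,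
`Φ` configuration-valid) the member `⟨b, max c₀ 0, r, Φ⟩` is in row 60's class with `c′ ≥ c₀` (`c′` is a free non-negative real
in `DetShiftDiscreteDesign`). [cite: Zhang2022LandauSiegel, §2 (2.13), Lemma 2.3, (2.18)–(2.19)] -/
theorem rplusplus19_row60_member (c₀ : ℝ) {b : Fin 3 → ℝ} (hb : SignAdmissible b) (hbox : InShiftBox b) (r : ℕ)
    {Φ : GramData r → ℝ} (hΦ : ConfigValid Φ) :
    (⟨b, max c₀ 0, r, Φ⟩ : DetShiftDiscreteDesign).InClass ∧ c₀ ≤ (⟨b, max c₀ 0, r, Φ⟩ : DetShiftDiscreteDesign).c' :=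
  ⟨⟨hb, hbox, le_max_right _ _, hΦ⟩, le_max_left _ _⟩

/-- **The §2 Cauchy–Schwarz endgame on a sign-admissible shift detector NEVER closes on the exact discrete means, for every
`c′ ≥ c₀` — no displayed input left** (`r = 2`, `Φ = csEndgame 0 1`; row 60 + `prop22_eventually`).
[cite: Zhang2022LandauSiegel, §2 (2.18)–(2.19), (2.34)] -/
theorem rplusplus19_row60_cs_closed :
    ∃ c₀ : ℝ, 0 ≤ c₀ ∧ ∀ (b : Fin 3 → ℝ), SignAdmissible b → ∀ hbox : InShiftBox b, ∀ c' : ℝ, c₀ ≤ c' →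
      ForAllLarge fun D _ χ => ∀ u : Fin 2 → (_ : Chr D) × ℂ → ℂ,
        ¬ (csEndgame 0 1 (((shiftDesign ⟨b, ![-1, 1, -1]⟩ hbox).detector c').gram χ u) < 0) := by
  obtain ⟨c₀, hc₀, h22⟩ := prop22_eventually
  exact ⟨c₀, hc₀, fun b hb hbox c' hc => detShiftDiscrete_cs_verdict hb hbox (hc₀.trans hc) (h22 _ hc)⟩

end Version19

end Repair

end Literature.NumberTheory.LFunctions.Zhang2022
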